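/-
Copyright (c) 2026 the pub-hodgecm-mathlib formalisation cell (harness21).  Prover seat hodgecm-mathlib-K2E1-p09 (g5), Track B ∕ K2-LIT,
h413 = `stmt-HodgeConjecture-24833`, line `K2_E1_TraceFormulaBeta`, campaign «EIS-WHITTAKER-2» rung «W5-A» of the dealer K2E1-plan (g4) 2026-09-04T07:20:40Z
(«the HYPOTHESIS-FIRST CAPSTONE … with NAMED inputs … keep `c̃`, `W̃` as FUNCTION ARGUMENTS with the properties as hypotheses»); REPORT-FIRST 07:21:58Z.
-/
import Summits.HodgeConjecture.HodgeConjecture.Theorems.K2E1WhittakerSeriesConvergenceU2   -- ★ p858248 (this seat): W4 — the lattice M-test, holomorphy ∕ continuity of `Σ_{ξ≠0} W(z, ξ)`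
import Mathlib.Analysis.Meromorphic.Basic
import Mathlib.Analysis.SpecialFunctions.Pow.Deriv
import Mathlib.Analysis.Complex.CauchyIntegral
import HarnessLib

/-!
# K2·E1 — `K2E1SphericalEisensteinContinuationU2`: THE HYPOTHESIS-FIRST CAPSTONE OF «EIS-WHITTAKER-2» — MEROMORPHIC CONTINUATION OF THE SPHERICAL EISENSTEIN SERIES OF `U(1,1)_{L∕L⁺}`
# TO `Re z > ½` WITH EXACTLY ONE POLE, SIMPLE, AT `z = 2ρ_H = 1`, RESIDUE A CONSTANT FUNCTION («(H4-b)₂-sph» MODULO ITS NAMED INPUTS)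

Track B ∕ K2-LIT, crux h413 = `stmt-HodgeConjecture-24833`, route of record `HCCMUnconditional`; cell `hodgecm-mathlib`, squad K2, ENGINE E1.  Prover seat `hodgecm-mathlib-K2E1-p09` (g5);
rung «W5-A» of the dealer K2E1-plan (g4) 07:20:40Z.  THEOREMS ONLY (no `def`, no `instance`, no notation, no named-fact hypothesis, no `sorry`); lane `--supports stmt-HodgeConjecture-24833
--as helper` (count-neutral).  Closes no socket.

THE MATHEMATICS [Garrett2018, §1.10–§1.12, §2.8–§2.11; Bump1997, §3.7; MoeglinWaldspurger1995, IV.1].  Hecke–Maass–Selberg: on `U(J₂)` over the CM pair `(L⁺, L)`, the spherical Eisenstein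
series `E(z, g) = E(φ₀·H^z)(g)` has, for `Re z > 1`, the Fourier expansion along `N(L⁺)∖N(𝔸) ≅ L⁺∖𝔸_{L⁺}`
`E(z, g) = φ₀·(H(g)^z + c(z)·H(g)^{1−z}) + μ(D)⁻¹·Σ_{ξ ∈ L⁺ˣ} Φ̂_{g,z}(ξ)` (W1 ★ `eisensteinSeriesU_sub_borelConstantTerm_eq_two` :224 + the constant term `f_z + M(w₀)f_z` ★ + the standard
intertwining integral `c(z)` ★ (R6k)₂ ∕ [D8]₂).  The inputs of the continuation are: a meromorphic continuation `c̃` of `c` to `U ⊇ {Re z > ½}` with a single (at most simple) pole at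
`z = 1` and `(z−1)·c̃(z) → r` [payer «W5-B»]; Whittaker coefficients `W̃(z, ξ)` holomorphic on `U` with W4's exponential-times-polynomial bounds and compact finite support, equal to `Φ̂_{g,z}`
on `Re z > 1` [payers W2 ★ ∕ W3 ∕ W3-cov]; and the expansion `hE` itself.  HYPOTHESIS-FIRST: `c̃`, `W̃`, `E` are FUNCTION ARGUMENTS, their properties NAMED hypotheses, and the continued
function is SPELLED OUT: `Ẽ(z) := φ₀·(h^z + c̃(z)·h^{1−z}) + κ·Σ_{ξ≠0} W̃(z, ξ)` (`h = H(g) > 0`, `κ = μ(D)⁻¹`).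
§1 **`continuousAt_tsum_of_differentiableOn`**, cpow continuity ∕ differentiability helpers.  §2 HEAD **`spherical_continuation_of_inputs`**: (a) `Ẽ` holomorphic on `U ∖ {1}`; (a′) `Ẽ`
meromorphic on `U`; (b) `Ẽ = E` on `U ∩ {Re z > 1}`; (c) `(z−1)·Ẽ(z) → φ₀·r` as `z → 1`, `z ≠ 1` — the residue at the unique pole `z = 2ρ_H = 1` is the CONSTANT `φ₀·Res₁c̃`, independent of
`h = H(g)` because `h^{1−1} = 1` («(H4-b)₂-sph: `L²_res ∩ sph = ℂ`», modulo the named inputs).  §3 **`continuousOn_regularPart_of_inputs`** (d): on any `S` (e.g. `{Re z ≥ ½}`) where W4's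
`𝓝[S]`-local polynomial bounds hold and every `W̃(·, ξ)` is continuous, the regular part `z ↦ φ₀·h^z + κ·Σ_{ξ≠0} W̃(z, ξ)` is continuous on `S`.
HONEST LABEL: HC_CM is proved only modulo the 7 printed citations (2 remaining named inputs: hLiu418 = `stmt-HodgeConjecture-24832`, h413 = `stmt-HodgeConjecture-24833`) until rung 0
closes; this file asserts no named fact and closes no socket; it is CONDITIONAL BY CONSTRUCTION on the named inputs `hc̃mer hc̃hol hc̃res hW̃hol hW̃bd hE` (payers W5-B, W3, W3-cov; W1,
W2-arch ★) — when they land, «(H4-b)₂-sph» is a theorem of the tree; no Mœglin–Waldspurger input is used.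
References: [Garrett2018] P. Garrett, *Modern Analysis of Automorphic Forms by Example* 1 (2018), §1.10–§1.12, §2.8–§2.11 · [Bump1997] D. Bump, *Automorphic Forms and Representations*
(1997), §3.7 · [MoeglinWaldspurger1995] IV.1 · [Langlands1976] R. P. Langlands, *On the Functional Equations Satisfied by Eisenstein Series*, LNM 544, §5 (the general statement, NOT used).
-/

set_option autoImplicit false
-- the mandated namespace repeats the single-problem summit's segment (`HodgeConjecture.HodgeConjecture`)
set_option linter.dupNamespace false

noncomputable section

open scoped Topology Classical
open NumberField IsDedekindDomain Set Filter Module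
open Summit.HodgeConjecture.HodgeConjecture.Cruxes.H413.K2E1WhittakerSeriesConvergenceU2

namespace Summit.HodgeConjecture.HodgeConjecture.Cruxes.H413.K2E1SphericalEisensteinContinuationU2

/-! ## §1 Helpers: continuity at a point of a holomorphic function, the powers `h^z`, `h^{1−z}` -/

/-- A function holomorphic on an open set is continuous at each of its points. [folklore] -/
theorem continuousAt_of_differentiableOn {U : Set ℂ} (hU : IsOpen U) {f : ℂ → ℂ} (hf : DifferentiableOn ℂ f U) {z : ℂ} (hz : z ∈ U) :
    ContinuousAt f z :=
  (hf.differentiableAt (hU.mem_nhds hz)).continuousAt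

/-- `z ↦ h^z` is entire for `h > 0`. [folklore] -/
theorem differentiable_const_cpow_of_pos {h : ℝ} (hh : 0 < h) : Differentiable ℂ fun z : ℂ => ((h : ℝ) : ℂ) ^ z :=
  fun z => differentiableAt_id.const_cpow (Or.inl (by exact_mod_cast hh.ne'))

/-- `z ↦ h^{1−z}` is entire for `h > 0`. [folklore] -/
theorem differentiable_const_cpow_one_sub_of_pos {h : ℝ} (hh : 0 < h) : Differentiable ℂ fun z : ℂ => ((h : ℝ) : ℂ) ^ (1 - z) :=
  fun z => ((differentiableAt_const (1 : ℂ)).sub differentiableAt_id).const_cpow (Or.inl (by exact_mod_cast hh.ne'))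

/-! ## §2 The capstone: `Ẽ(z) = φ₀·(h^z + c̃(z)·h^{1−z}) + κ·Σ_{ξ≠0} W̃(z, ξ)` is meromorphic on `U`, holomorphic off `z = 1`, equals `E` on `Re z > 1`, simple pole at `1` with residue `φ₀·r` -/

variable (K : Type) [Field K] [NumberField K]

/-- **«(H4-b)₂-sph» MODULO ITS NAMED INPUTS — THE HYPOTHESIS-FIRST CAPSTONE OF «EIS-WHITTAKER-2».**  Inputs (payers in brackets): `U` open with `1 ∈ U` (consumer: `{Re z > ½}`);
`c̃` meromorphic on `U`, holomorphic on `U ∖ {1}`, `(z−1)·c̃(z) → r` at `1` [W5-B]; `W̃ : ℂ → K → ℂ` with every `z ↦ W̃(z, ξ)`, `ξ ≠ 0`, holomorphic on `U` and, around every point of `U`, ONE bound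
`‖W̃(z, ξ)‖ ≤ M·e^{−b‖ξ_∞‖}·(1+‖ξ_∞‖)^a` with ONE compact `ξ_f`-support [W2 ★, W3, W3-cov]; `φ₀ κ : ℂ`, `h > 0`; `E : ℂ → ℂ` with the Fourier expansion `hE` on `U ∩ {Re z > 1}` [W1 ★, constant
term ★, (R6k)₂ ★, W3].  Conclusions for `Ẽ(z) := φ₀·(h^z + c̃(z)·h^{1−z}) + κ·Σ_{ξ≠0} W̃(z, ξ)`: (a) holomorphic on `U ∖ {1}`; (a′) meromorphic on `U`; (b) `= E` on `U ∩ {Re z > 1}`;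
(c) `(z−1)·Ẽ(z) → φ₀·r` (`z → 1`, `z ≠ 1`): the residue at the unique possible pole `z = 2ρ_H = 1` is the constant `φ₀·r`, independent of `h` (`h^{1−1} = 1`).
[cite: Garrett2018, §1.10–§1.12 and §2.8–§2.11] [cite: Bump1997, §3.7] [cite: MoeglinWaldspurger1995, IV.1] -/
theorem spherical_continuation_of_inputs {U : Set ℂ} (hU : IsOpen U) (h1U : (1 : ℂ) ∈ U)
    {c : ℂ → ℂ} (hcmer : MeromorphicOn c U) (hchol : DifferentiableOn ℂ c (U \ {1})) {r : ℂ} (hcres : Tendsto (fun z : ℂ => (z - 1) * c z) (𝓝[≠] 1) (𝓝 r))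
    {W : ℂ → K → ℂ} (hWhol : ∀ ξ : K, ξ ≠ 0 → DifferentiableOn ℂ (fun z => W z ξ) U)
    (hWbd : ∀ z₀ ∈ U, ∃ V ∈ 𝓝 z₀, ∃ (M b a : ℝ) (Cf : Set (FiniteAdeleRing (𝓞 K) K)), 0 ≤ M ∧ 0 < b ∧ IsCompact Cf ∧
      ∀ z ∈ V, ∀ ξ : K,
        ‖W z ξ‖ ≤ M * Real.exp (-(b * ‖InfiniteAdeleRing.ringEquiv_mixedSpace K (algebraMap K (AdeleRing (𝓞 K) K) ξ).1‖)) *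
          (1 + ‖InfiniteAdeleRing.ringEquiv_mixedSpace K (algebraMap K (AdeleRing (𝓞 K) K) ξ).1‖) ^ a ∧
        ((algebraMap K (AdeleRing (𝓞 K) K) ξ).2 ∉ Cf → W z ξ = 0))
    (φ₀ κ : ℂ) {h : ℝ} (hh : 0 < h) {E : ℂ → ℂ}
    (hE : ∀ z ∈ U, 1 < z.re → E z = φ₀ * (((h : ℝ) : ℂ) ^ z + c z * ((h : ℝ) : ℂ) ^ (1 - z)) + κ * ∑' ξ : K, ({0}ᶜ : Set K).indicator (fun ξ => W z ξ) ξ) :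
    DifferentiableOn ℂ (fun z => φ₀ * (((h : ℝ) : ℂ) ^ z + c z * ((h : ℝ) : ℂ) ^ (1 - z)) + κ * ∑' ξ : K, ({0}ᶜ : Set K).indicator (fun ξ => W z ξ) ξ) (U \ {1}) ∧
    MeromorphicOn (fun z => φ₀ * (((h : ℝ) : ℂ) ^ z + c z * ((h : ℝ) : ℂ) ^ (1 - z)) + κ * ∑' ξ : K, ({0}ᶜ : Set K).indicator (fun ξ => W z ξ) ξ) U ∧
    (∀ z ∈ U, 1 < z.re → φ₀ * (((h : ℝ) : ℂ) ^ z + c z * ((h : ℝ) : ℂ) ^ (1 - z)) + κ * ∑' ξ : K, ({0}ᶜ : Set K).indicator (fun ξ => W z ξ) ξ = E z) ∧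
    Tendsto (fun z : ℂ => (z - 1) * (φ₀ * (((h : ℝ) : ℂ) ^ z + c z * ((h : ℝ) : ℂ) ^ (1 - z)) + κ * ∑' ξ : K, ({0}ᶜ : Set K).indicator (fun ξ => W z ξ) ξ)) (𝓝[≠] 1) (𝓝 (φ₀ * r)) := by
  -- the Whittaker part `S(z) = Σ_{ξ≠0} W̃(z, ξ)` is holomorphic on `U` (W4)
  obtain ⟨-, -, hS⟩ := summable_differentiableOn_tsum_of_exp_bounds K hU hWhol hWbd
  have hh0 : ((h : ℝ) : ℂ) ≠ 0 := by exact_mod_cast hh.ne'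
  have hp1 : Differentiable ℂ fun z : ℂ => ((h : ℝ) : ℂ) ^ z := differentiable_const_cpow_of_pos hh
  have hp2 : Differentiable ℂ fun z : ℂ => ((h : ℝ) : ℂ) ^ (1 - z) := differentiable_const_cpow_one_sub_of_pos hh
  have hU1 : IsOpen (U \ {1}) := hU.sdiff isClosed_singleton
  -- (a) holomorphy off `z = 1`
  have ha : DifferentiableOn ℂ (fun z => φ₀ * (((h : ℝ) : ℂ) ^ z + c z * ((h : ℝ) : ℂ) ^ (1 - z)) + κ * ∑' ξ : K, ({0}ᶜ : Set K).indicator (fun ξ => W z ξ) ξ) (U \ {1}) :=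
    ((hp1.differentiableOn.add (hchol.mul hp2.differentiableOn)).const_mul φ₀).add ((hS.mono fun z hz => hz.1).const_mul κ)
  -- (a′) meromorphy on `U`
  have ha' : MeromorphicOn (fun z => φ₀ * (((h : ℝ) : ℂ) ^ z + c z * ((h : ℝ) : ℂ) ^ (1 - z)) + κ * ∑' ξ : K, ({0}ᶜ : Set K).indicator (fun ξ => W z ξ) ξ) U :=
    (((hp1.differentiableOn.analyticOnNhd hU).meromorphicOn.fun_add (hcmer.fun_mul (hp2.differentiableOn.analyticOnNhd hU).meromorphicOn)).const_smul φ₀ |>.congr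
      (fun z _ => by simp only [Pi.smul_apply, smul_eq_mul]) hU).fun_add
      (((hS.analyticOnNhd hU).meromorphicOn.const_smul κ).congr (fun z _ => by simp only [Pi.smul_apply, smul_eq_mul]) hU)
  refine ⟨ha, ha', fun z hz hz1 => (hE z hz hz1).symm, ?_⟩
  -- (c) the residue at `z = 1`
  have hSc : ContinuousAt (fun z => ∑' ξ : K, ({0}ᶜ : Set K).indicator (fun ξ => W z ξ) ξ) 1 := continuousAt_of_differentiableOn hU hS h1U
  have hz1 : Tendsto (fun z : ℂ => z - 1) (𝓝[≠] (1 : ℂ)) (𝓝 0) := by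
    have h0 : Tendsto (fun z : ℂ => z - 1) (𝓝 (1 : ℂ)) (𝓝 ((1 : ℂ) - 1)) := (continuous_id.sub continuous_const).tendsto 1
    rw [sub_self] at h0
    exact h0.mono_left nhdsWithin_le_nhds
  have hc1 : Tendsto (fun z : ℂ => ((h : ℝ) : ℂ) ^ z) (𝓝[≠] (1 : ℂ)) (𝓝 (((h : ℝ) : ℂ) ^ (1 : ℂ))) := (hp1 1).continuousAt.tendsto.mono_left nhdsWithin_le_nhds
  have hc2 : Tendsto (fun z : ℂ => ((h : ℝ) : ℂ) ^ (1 - z)) (𝓝[≠] (1 : ℂ)) (𝓝 (((h : ℝ) : ℂ) ^ (1 - (1 : ℂ)))) := (hp2 1).continuousAt.tendsto.mono_left nhdsWithin_le_nhds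
  have hc3 : Tendsto (fun z => ∑' ξ : K, ({0}ᶜ : Set K).indicator (fun ξ => W z ξ) ξ) (𝓝[≠] (1 : ℂ)) (𝓝 (∑' ξ : K, ({0}ᶜ : Set K).indicator (fun ξ => W 1 ξ) ξ)) :=
    hSc.tendsto.mono_left nhdsWithin_le_nhds
  have hlim := ((((hz1.mul hc1).const_mul φ₀).add ((hcres.mul hc2).const_mul φ₀)).add ((hz1.mul hc3).const_mul κ))
  rw [sub_self, Complex.cpow_zero, zero_mul, mul_zero, zero_add, mul_one, zero_mul, mul_zero, add_zero] at hlim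
  refine hlim.congr fun z => ?_
  ring

/-! ## §3 (d) Continuity of the regular part up to the boundary -/

/-- **CONTINUITY OF THE REGULAR PART UP TO THE BOUNDARY** (for W5's «continuous to `Re z = ½`» clause): on any `S ⊆ ℂ` where every `z ↦ W̃(z, ξ)`, `ξ ≠ 0`, is continuous and around
every point of `S` a neighbourhood WITHIN `S` carries ONE polynomial bound `M·(1+‖ξ_∞‖)^{−k}` (`k > [K:ℚ]`) with ONE compact `ξ_f`-support, the regular part
`z ↦ φ₀·h^z + κ·Σ_{ξ≠0} W̃(z, ξ)` is continuous on `S` (★ W4 `summable_continuousOn_tsum_of_rpow_bounds` + continuity of `h^z`). [cite: Garrett2018, §1.10] [cite: Bump1997, §3.7] -/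
theorem continuousOn_regularPart_of_inputs {S : Set ℂ} {W : ℂ → K → ℂ}
    (hWcont : ∀ ξ : K, ξ ≠ 0 → ContinuousOn (fun z => W z ξ) S)
    (hWbd : ∀ z₀ ∈ S, ∃ V ∈ 𝓝[S] z₀, ∃ (M : ℝ) (k : ℕ) (Cf : Set (FiniteAdeleRing (𝓞 K) K)), 0 ≤ M ∧ finrank ℚ K < k ∧ IsCompact Cf ∧
      ∀ z ∈ V, ∀ ξ : K, ‖W z ξ‖ ≤ M * (1 + ‖InfiniteAdeleRing.ringEquiv_mixedSpace K (algebraMap K (AdeleRing (𝓞 K) K) ξ).1‖) ^ (-(k : ℝ)) ∧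
        ((algebraMap K (AdeleRing (𝓞 K) K) ξ).2 ∉ Cf → W z ξ = 0))
    (φ₀ κ : ℂ) {h : ℝ} (hh : 0 < h) :
    ContinuousOn (fun z => φ₀ * ((h : ℝ) : ℂ) ^ z + κ * ∑' ξ : K, ({0}ᶜ : Set K).indicator (fun ξ => W z ξ) ξ) S := by
  obtain ⟨-, hS⟩ := summable_continuousOn_tsum_of_rpow_bounds K hWcont hWbd
  exact ((differentiable_const_cpow_of_pos hh).continuous.continuousOn.const_smul φ₀ |>.congr fun z _ => by simp only [Pi.smul_apply, smul_eq_mul]).add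
    (hS.const_smul κ |>.congr fun z _ => by simp only [Pi.smul_apply, smul_eq_mul])

end Summit.HodgeConjecture.HodgeConjecture.Cruxes.H413.K2E1SphericalEisensteinContinuationU2

end
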